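import Summits.PneNP.PneNP.Theorems.ConvexRankGatesCliqueExtLowerBoundWidthThresholdDefs
import Summits.PneNP.PneNP.Theorems.ConvexRankGatesCliqueExtLowerBoundStubInline
import Summits.PneNP.PneNP.Theorems.ConvexRankGatesCliqueExtLowerBoundStubAndThresholdAssembly
import Summits.PneNP.PneNP.Theorems.ConvexRankGatesCliqueExtLowerBoundConvHellyReduction
import Literature.Computability.Complexity.MonotoneSwitchingLeafPairs

/-!
# Real inline freeness from the real-gate engine (line `width-threshold-certificate-sparsity`, reshape r6)

`realInline_of_engine`: IF every monotone real straight-line program over leaves carrying local pairs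
admits two-valued approximators with global correcting families `Cf` (exact `s`-clauses,
`≤ T·(K(r-1))^s`) and `Df` (exact `r`-monomials, `≤ T·(s-1)^r`) — the REAL-GATE ENGINE, Jukna 2012
Thm 9.21 in leaf-pair form, taken here as the hypothesis — THEN every such program of length `≤ m^a`
and fan-in `≤ ⌊m^{1/16}⌋₊`, fed with local child pairs over the edges of `K_m`, has an output
sandwich pair with error `1/(8 m^{c+1})` on both referee families (bare `⌈m^{1/4}⌉`-cliques;
complements of `(#E/⌊m^{1/8}⌋)`-sets), once `r ≥ r₀(a,c)`, `s ≥ s₀(a,c)` and `m` is large.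
Proof: exactly as `…StubInline.stub_inline` (same mass lemmas `card_filter_evalDNF_cliqueVec_mul_pow_le`,
`card_filter_not_evalCNF_compl_mul_pow_le`), with `(r-1)^s` replaced by `(⌊m^{1/16}⌋₊ (r-1))^s`
(absorbed by `⌊m^{1/8}⌋₊ ≥ ⌊m^{1/16}⌋₊²` and a larger `s₀`).
-/

set_option linter.dupNamespace false

open Literature.Computability.Complexity Filter Finset

namespace Summit.PneNP.PneNP.Theorems.CliqueExtLowerBound.WidthThreshold.RealInline

open Summit.PneNP.PneNP.Theorems.CliqueExtLowerBound.WidthThreshold.Inline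

/-! ### Integer sandwich for `⌊m^{1/16}⌋₊` and the real-program negative budget -/

/-- Integer sandwich for `F = ⌊m^{1/16}⌋₊`: `F^16 ≤ m`. [folklore] -/
theorem floor_pow_sixteen_le (m : ℕ) : ⌊(m : ℝ) ^ (1 / 16 : ℝ)⌋₊ ^ 16 ≤ m := by
  have h := Nat.floor_le (Real.rpow_nonneg (Nat.cast_nonneg m) (1 / 16 : ℝ))
  have h16 : ((m : ℝ) ^ (1 / 16 : ℝ)) ^ 16 = m := by
    have := rpow_one_div_natCast_pow (x := (m : ℝ)) (by positivity) (n := 16) (by norm_num)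
    norm_num at this; exact this
  have : ((⌊(m : ℝ) ^ (1 / 16 : ℝ)⌋₊ : ℕ) : ℝ) ^ 16 ≤ (m : ℝ) := by
    calc ((⌊(m : ℝ) ^ (1 / 16 : ℝ)⌋₊ : ℕ) : ℝ) ^ 16 ≤ ((m : ℝ) ^ (1 / 16 : ℝ)) ^ 16 :=
          pow_le_pow_left₀ (by positivity) h 16
      _ = m := h16
  exact_mod_cast this

/-- Integer sandwich for `F = ⌊m^{1/16}⌋₊`: `m < (F+1)^16`. [folklore] -/
theorem lt_floor_add_one_pow_sixteen (m : ℕ) : m < (⌊(m : ℝ) ^ (1 / 16 : ℝ)⌋₊ + 1) ^ 16 := by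
  have hlt := Nat.lt_floor_add_one ((m : ℝ) ^ (1 / 16 : ℝ))
  have h16 : ((m : ℝ) ^ (1 / 16 : ℝ)) ^ 16 = m := by
    have := rpow_one_div_natCast_pow (x := (m : ℝ)) (by positivity) (n := 16) (by norm_num)
    norm_num at this; exact this
  have : (m : ℝ) < (((⌊(m : ℝ) ^ (1 / 16 : ℝ)⌋₊ + 1 : ℕ)) : ℝ) ^ 16 := by
    calc (m : ℝ) = ((m : ℝ) ^ (1 / 16 : ℝ)) ^ 16 := h16.symm
      _ < _ := by
        push_cast
        exact pow_lt_pow_left₀ hlt (by positivity) (by norm_num)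
  exact_mod_cast this

/-- `⌊m^{1/16}⌋₊ · ⌊m^{1/16}⌋₊ ≤ ⌊m^{1/8}⌋₊`, from the sandwiches `F^16 ≤ m < (D+1)^8`. [folklore] -/
theorem floor_sixteenth_mul_self_le_floor_eighth (m : ℕ) :
    ⌊(m : ℝ) ^ (1 / 16 : ℝ)⌋₊ * ⌊(m : ℝ) ^ (1 / 16 : ℝ)⌋₊ ≤ ⌊(m : ℝ) ^ (1 / 8 : ℝ)⌋₊ := by
  set F := ⌊(m : ℝ) ^ (1 / 16 : ℝ)⌋₊
  set Dm := ⌊(m : ℝ) ^ (1 / 8 : ℝ)⌋₊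
  have h1 : (F * F) ^ 8 < (Dm + 1) ^ 8 :=
    calc (F * F) ^ 8 = F ^ 16 := by ring
      _ ≤ m := floor_pow_sixteen_le m
      _ < (Dm + 1) ^ 8 := lt_floor_add_one_pow_eight m
  have := (Nat.pow_lt_pow_iff_left (by norm_num : (8 : ℕ) ≠ 0)).1 h1
  omega

/-- Negative-side budget for real programs: `8 m^{c+1} · m^a (F(r-1))^s ≤ D^s` once `F·F ≤ D`,
`m < (F+1)^16`, `1 ≤ F`, `r - 1 ≤ F`, `s ≥ 16(a+c+2)` and
`8 · 65536^{a+c+2} (r-1)^{16(a+c+2)} ≤ m`. [folklore] -/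
theorem neg_numerics' {m F D a c r s : ℕ} (hFD : F * F ≤ D) (hF : m < (F + 1) ^ 16) (hF1 : 1 ≤ F)
    (hrF : r - 1 ≤ F) (hs : 16 * (a + c + 2) ≤ s)
    (hm : 8 * 65536 ^ (a + c + 2) * (r - 1) ^ (16 * (a + c + 2)) ≤ m) :
    8 * m ^ (c + 1) * (m ^ a * (F * (r - 1)) ^ s) ≤ D ^ s := by
  set L := a + c + 2 with hL
  have h65536 : m ≤ 65536 * F ^ 16 := by
    have h1 : (F + 1) ^ 16 ≤ (2 * F) ^ 16 := Nat.pow_le_pow_left (by omega) 16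
    have h2 : (2 * F) ^ 16 = 65536 * F ^ 16 := by ring
    omega
  have hmL : m ^ L ≤ 65536 ^ L * F ^ (16 * L) := by
    calc m ^ L ≤ (65536 * F ^ 16) ^ L := Nat.pow_le_pow_left h65536 L
      _ = 65536 ^ L * F ^ (16 * L) := by rw [mul_pow, ← pow_mul]
  obtain ⟨e, rfl⟩ : ∃ e, s = 16 * L + e := ⟨s - 16 * L, by omega⟩
  have key : 65536 ^ L * (8 * m ^ (c + 1) * (m ^ a * (r - 1) ^ (16 * L))) ≤
      65536 ^ L * F ^ (16 * L) := by
    calc 65536 ^ L * (8 * m ^ (c + 1) * (m ^ a * (r - 1) ^ (16 * L)))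
        = m ^ (a + c + 1) * (8 * 65536 ^ L * (r - 1) ^ (16 * L)) := by ring
      _ ≤ m ^ (a + c + 1) * m := Nat.mul_le_mul_left _ hm
      _ = m ^ L := by rw [hL]; ring
      _ ≤ 65536 ^ L * F ^ (16 * L) := hmL
  have key' : 8 * m ^ (c + 1) * (m ^ a * (r - 1) ^ (16 * L)) ≤ F ^ (16 * L) :=
    Nat.le_of_mul_le_mul_left key (Nat.pow_pos (by norm_num))
  calc 8 * m ^ (c + 1) * (m ^ a * (F * (r - 1)) ^ (16 * L + e))
      = F ^ (16 * L + e) * ((8 * m ^ (c + 1) * (m ^ a * (r - 1) ^ (16 * L))) * (r - 1) ^ e) := by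
        ring
    _ ≤ F ^ (16 * L + e) * (F ^ (16 * L) * F ^ e) :=
        Nat.mul_le_mul_left _ (Nat.mul_le_mul key' (Nat.pow_le_pow_left hrF e))
    _ = (F * F) ^ (16 * L + e) := by ring
    _ ≤ D ^ (16 * L + e) := Nat.pow_le_pow_left hFD _

open Classical in
/-- **Registered stub `realInline_of_engine`** (crux stmt-PneNP-10682, line `width-threshold-certificate-sparsity`,
reshape r6). [cite: Jukna2012, Thm. 9.21] -/
theorem realInline_of_engine : (∀ (ι : Type) [Fintype ι] [DecidableEq ι] (n r s T K : ℕ) (Dl Cl : Fin n → Finset (Finset ι)) (cv dv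
    : (ι → Bool) → Fin n → Bool), (∀ j, ∀ R ∈ Dl j, #R ≤ r - 1) → (∀ j, ∀ S ∈ Cl j, #S ≤ s - 1) → (∀
    j x, EvalDNF (Dl j) x → EvalCNF (Cl j) x) → (∀ j x, EvalCNF (Cl j) x → cv x j = true) → (∀ j x,
    dv x j = true → EvalDNF (Dl j) x) → ∀ ev : (Fin n → Bool) → Fin T → ℝ, (∀ t : Fin T, ∃ (k : ℕ)
    (src : Fin k → Fin n ⊕ Fin T) (φ : (Fin k → ℝ) → ℝ), k ≤ K ∧ (∀ i t', src i = Sum.inr t' → t' <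
    t) ∧ Monotone φ ∧ ∀ u : Fin n → Bool, ev u t = φ (fun i => Sum.elim (fun j => if u j then (1 :
    ℝ) else 0) (ev u) (src i))) → ∃ Cf Df : Finset (Finset ι), (∀ P ∈ Cf, #P = s) ∧ (∀ P ∈ Df, #P =
    r) ∧ #Cf ≤ T * (K * (r - 1)) ^ s ∧ #Df ≤ T * (s - 1) ^ r ∧ ∀ (t : Fin T) (a : ℝ), ∃ dnf cnf :
    Finset (Finset ι), (∀ R ∈ dnf, #R ≤ r - 1) ∧ (∀ S ∈ cnf, #S ≤ s - 1) ∧ (∀ x, EvalDNF dnf x →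
    EvalCNF cnf x) ∧ (∀ x, EvalCNF Cf x → EvalCNF cnf x → a ≤ ev (cv x) t) ∧ (∀ x, a ≤ ev (dv x) t →
    EvalDNF dnf x ∨ EvalDNF Df x)) → ∀ a c : ℕ, ∃ r₀ s₀ : ℕ, 2 ≤ r₀ ∧ 2 ≤ s₀ ∧ ∀ r s : ℕ, r₀ ≤ r →
    s₀ ≤ s → ∀ᶠ m : ℕ in atTop, ∀ (n T K : ℕ) (ev : (Fin n → Bool) → Fin T → ℝ), (∀ t : Fin T, ∃ (k
    : ℕ) (src : Fin k → Fin n ⊕ Fin T) (φ : (Fin k → ℝ) → ℝ), k ≤ K ∧ (∀ i t', src i = Sum.inr t' →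
    t' < t) ∧ Monotone φ ∧ ∀ u : Fin n → Bool, ev u t = φ (fun i => Sum.elim (fun j => if u j then
    (1 : ℝ) else 0) (ev u) (src i))) → T ≤ m ^ a → K ≤ ⌊(m : ℝ) ^ (1 / 16 : ℝ)⌋₊ → ∀ (t : Fin T) (θ
    : ℝ) (D C : Fin n → Finset (Finset ((⊤ : SimpleGraph (Fin m)).edgeSet))), (∀ j, ∀ R ∈ D j, #R ≤
    r - 1) → (∀ j, ∀ S ∈ C j, #S ≤ s - 1) → (∀ j x, EvalDNF (D j) x → EvalCNF (C j) x) → ∃ dnf cnf :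
    Finset (Finset ((⊤ : SimpleGraph (Fin m)).edgeSet)), (∀ R ∈ dnf, #R ≤ r - 1) ∧ (∀ S ∈ cnf, #S ≤
    s - 1) ∧ (∀ x, EvalDNF dnf x → EvalCNF cnf x) ∧ (#((posGraphs m ⌈(m : ℝ) ^ (1 / 4 : ℝ)⌉₊).filter
    (fun x => θ ≤ ev (fun j => decide (EvalDNF (D j) x)) t ∧ ¬ EvalDNF dnf x)) : ℝ) ≤ (1 / (8 * (m :
    ℝ) ^ (c + 1))) * #(posGraphs m ⌈(m : ℝ) ^ (1 / 4 : ℝ)⌉₊) ∧ (#((((powersetCard (Fintype.card ((⊤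
    : SimpleGraph (Fin m)).edgeSet) / ⌊(m : ℝ) ^ (1 / 8 : ℝ)⌋₊) (univ : Finset ((⊤ : SimpleGraph
    (Fin m)).edgeSet))).image (fun M => fun e => decide (e ∉ M)))).filter (fun x => EvalCNF cnf x ∧
    ¬ θ ≤ ev (fun j => decide (EvalCNF (C j) x)) t)) : ℝ) ≤ (1 / (8 * (m : ℝ) ^ (c + 1))) *
    #(((powersetCard (Fintype.card ((⊤ : SimpleGraph (Fin m)).edgeSet) / ⌊(m : ℝ) ^ (1 / 8 : ℝ)⌋₊)
    (univ : Finset ((⊤ : SimpleGraph (Fin m)).edgeSet))).image (fun M => fun e => decide (e ∉ M)))) := by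
  intro hE a c
  refine ⟨(4 * (a + c + 2)).choose 2 + 2, 16 * (a + c + 2) + 2, by omega, by omega,
    fun r s hr hs => ?_⟩
  filter_upwards [eventually_ge_atTop 17, eventually_ge_atTop (8 * (s - 1) ^ r),
    eventually_ge_atTop (r ^ 16),
    eventually_ge_atTop (8 * 65536 ^ (a + c + 2) * (r - 1) ^ (16 * (a + c + 2)))]
    with m hm17 hmP hmr hmN
  intro n T K ev hev hT hK t θ D C hD hC hDC
  obtain ⟨Cf, Df, hCf, hDf, hcC, hcD, hpair⟩ := hE _ n r s T K D C
    (fun x j => decide (EvalCNF (C j) x)) (fun x j => decide (EvalDNF (D j) x)) hD hC hDC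
    (fun j x hx => decide_eq_true hx) (fun j x hx => of_decide_eq_true hx) ev hev
  obtain ⟨dnf, cnf, hdnf, hcnf, hle, hlow, hupp⟩ := hpair t θ
  refine ⟨dnf, cnf, hdnf, hcnf, hle, ?_, ?_⟩
  · -- positives: the error set lies inside `{x ∈ P : EvalDNF Df x}`
    set k := ⌈(m : ℝ) ^ (1 / 4 : ℝ)⌉₊ with hk
    have hk4 : m ≤ k ^ 4 := le_ceil_pow_four m
    have hk1 : (k - 1) ^ 4 < m := ceil_sub_one_pow_four_lt (by omega)
    have hk3 : 3 ≤ k := by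
      by_contra h
      have : k ^ 4 ≤ 2 ^ 4 := Nat.pow_le_pow_left (by omega) 4
      omega
    have hkk : k * k ≤ m := by
      have h2 : k ≤ (k - 1) * (k - 1) :=
        calc k ≤ 2 * (k - 1) := by omega
          _ ≤ (k - 1) * (k - 1) := Nat.mul_le_mul_right _ (by omega)
      calc k * k ≤ ((k - 1) * (k - 1)) * ((k - 1) * (k - 1)) := Nat.mul_le_mul h2 h2
        _ = (k - 1) ^ 4 := by ring
        _ ≤ m := hk1.le
    have hP : #(posGraphs m k) = m.choose k := card_posGraphs (by omega)
    have hDf' : ∀ R ∈ Df, (4 * (a + c + 2)).choose 2 < #R := fun R hR => by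
      rw [hDf R hR]; omega
    have h1 := card_filter_evalDNF_cliqueVec_mul_pow_le (k := k) (d := 4 * (a + c + 2))
      (by omega : 1 ≤ k) hkk Df hDf'
    have h2 : 8 * m ^ (c + 1) * #Df ≤ k ^ (4 * (a + c + 2)) :=
      calc 8 * m ^ (c + 1) * #Df ≤ 8 * m ^ (c + 1) * (m ^ a * (s - 1) ^ r) :=
            Nat.mul_le_mul_left _ (hcD.trans (Nat.mul_le_mul_right _ hT))
        _ ≤ _ := pos_numerics hk4 hmP
    refine cast_le_eps_mul (by omega) (mul_le_of_mul_le_mul ?_ h2 (Nat.pow_pos (by omega)))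
    rw [hP]
    refine le_trans (Nat.mul_le_mul_right _ ?_) h1
    calc _ ≤ #(((powersetCard k univ).filter fun K => EvalDNF Df (cliqueVec K)).image cliqueVec) := by
          refine card_le_card fun x hx => ?_
          rw [Finset.mem_filter] at hx
          obtain ⟨K, hK, rfl⟩ := Finset.mem_image.1 hx.1
          exact Finset.mem_image.2 ⟨K, Finset.mem_filter.2
            ⟨hK, (hupp _ hx.2.1).resolve_left hx.2.2⟩, rfl⟩
      _ ≤ _ := card_image_le
  · -- negatives: the error set lies inside `{x ∈ N : ¬ EvalCNF Cf x}`
    set Dm := ⌊(m : ℝ) ^ (1 / 8 : ℝ)⌋₊ with hDm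
    set F := ⌊(m : ℝ) ^ (1 / 16 : ℝ)⌋₊ with hF
    set N₀ := Fintype.card ((⊤ : SimpleGraph (Fin m)).edgeSet) with hN₀
    have hF16 : m < (F + 1) ^ 16 := lt_floor_add_one_pow_sixteen m
    have hFD : F * F ≤ Dm := floor_sixteenth_mul_self_le_floor_eighth m
    have hrF : r ≤ F := by
      by_contra h
      have : (F + 1) ^ 16 ≤ r ^ 16 := Nat.pow_le_pow_left (by omega) 16
      omega
    have hF1 : 1 ≤ F := by omega
    have hFF : 1 * 1 ≤ F * F := Nat.mul_le_mul hF1 hF1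
    have hD1 : 1 ≤ Dm := by omega
    have h1 := card_filter_not_evalCNF_compl_mul_pow_le (q := N₀ / Dm) (c := Dm) (v := s) hD1
      (Nat.div_mul_le_self N₀ Dm) Cf hCf
    have hN : #((powersetCard (N₀ / Dm) (univ : Finset ((⊤ : SimpleGraph (Fin m)).edgeSet))).image
        fun M => fun e => decide (e ∉ M)) = N₀.choose (N₀ / Dm) := by
      rw [card_image_complVec, card_powersetCard, card_univ]
    have h2 : 8 * m ^ (c + 1) * #Cf ≤ Dm ^ s :=
      calc 8 * m ^ (c + 1) * #Cf ≤ 8 * m ^ (c + 1) * (m ^ a * (F * (r - 1)) ^ s) :=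
            Nat.mul_le_mul_left _ (hcC.trans
              (Nat.mul_le_mul hT (Nat.pow_le_pow_left (Nat.mul_le_mul_right _ hK) s)))
        _ ≤ _ := neg_numerics' hFD hF16 hF1 (by omega) (by omega) hmN
    refine cast_le_eps_mul (by omega) (mul_le_of_mul_le_mul ?_ h2 (Nat.pow_pos hD1))
    rw [hN]
    refine le_trans (Nat.mul_le_mul_right _ ?_) h1
    calc _ ≤ #(((powersetCard (N₀ / Dm) univ).filter fun M =>
            ¬ EvalCNF Cf (fun e => decide (e ∉ M))).image fun M => fun e => decide (e ∉ M)) := by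
          refine card_le_card fun x hx => ?_
          rw [Finset.mem_filter] at hx
          obtain ⟨M, hM, rfl⟩ := Finset.mem_image.1 hx.1
          exact Finset.mem_image.2 ⟨M, Finset.mem_filter.2
            ⟨hM, fun hCfx => hx.2.2 (hlow _ hCfx hx.2.1)⟩, rfl⟩
      _ ≤ _ := card_image_le

end Summit.PneNP.PneNP.Theorems.CliqueExtLowerBound.WidthThreshold.RealInline
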